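import Mathlib
import Summits.Ventures.HodgeRepro.Tier4.Line4.L1ClassV3
import Summits.Ventures.HodgeRepro.Tier4.Line4.ArchDistBounds
import Summits.Ventures.HodgeRepro.Tier4.Line4.ArchBallReduce
import Summits.Ventures.HodgeRepro.Tier4.Line4.ArchProdCoeff
import Summits.Ventures.HodgeRepro.Tier4.Line4.ArchMatching

/-!
# Tier4/Line4/ArchIntegrableOfGrowth — the `G_∞`-INTEGRABILITY of a weight-3-decaying function from the ARCHIMEDEAN BALL
GROWTH: `‖f‖ ≤ C₀ e^{−3 archDist}` and `μ∞{archDist ≤ T} ≤ C e^{αT}` with `α < 3` give `f ∈ L¹(G_∞, μ∞)` (layer cake over the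
integer shells `n ≤ archDist < n + 1`, a geometric series of ratio `e^{α − 3} < 1`) — so the `integrable` print `hinf` of the
(7a) witness is the SAME print as display (8)'s `ArchBallGrowth`

Blind re-derivation cell `pub-hodge-repro`, Tier 4 (README §9–§10), seat t4-L1-p5 (prover, gen 5; the (7a) print census
S15418: `integrable` = `hinf`; L4-p2's `ArchBallReduce` narrowed (8)'s print to `ArchBallGrowth W μ∞`, S15436 — this module
shows `hinf` follows from it).  Target tree path `lean/Summits/Ventures/HodgeRepro/Tier4/Line4/ArchIntegrableOfGrowth.lean`.
On L2-p1's `ArchDistBounds` (`continuous_archDist`), L4-p1's `L1ClassV3` (`archDist_nonneg`, `HasDecay3`), L4-p2's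
`ArchBallReduce` (`ArchBallGrowth`) and the seat's `ArchProdCoeff` (`decay_archWitness(')`); no printed input.

THE ARGUMENT.  For `a ∈ G_∞` with `n₀ := ⌊archDist a⌋₊`, `‖f a‖ ≤ C₀ e^{−3 archDist a} ≤ C₀ e^{−3 n₀}` and `a ∈ {archDist ≤ n₀ + 1}`,
so pointwise `‖f a‖ₑ ≤ ∑'_n 1_{archDist ≤ n + 1}(a) · C₀ e^{−3n}` (one term of a non-negative series); integrating
(`lintegral_tsum`, the sublevel sets closed by `continuous_archDist`) and `μ∞{archDist ≤ n + 1} ≤ C e^{α(n + 1)}`: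
`∫ ‖f‖ ≤ ∑_n C₀ C e^{α} e^{(α − 3) n} < ∞`.

WHAT IS PROVED (kernel, no print): `enorm_le_tsum_indicator_of_decay` (the pointwise shell bound),
`lintegral_enorm_le_of_decay_of_archBallGrowth`, **`integrable_of_decay_of_archBallGrowth`** (`Continuous f` +
`HasDecay3`-form bound + `ArchBallGrowth W μ∞` ⇒ `Integrable (fun a : infinitePart W => f a) μ∞`), and its instances
**`integrable_archWitness_of_archBallGrowth` / `integrable_archWitness'_of_archBallGrowth`** (the `hinf` of
`isArchCoeffD_archWitness(')` from `ArchBallGrowth` under the decay hypotheses of `decay_archWitness(')`), and the FINAL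
**`d3CoeffData'_archWitness(')_of_archBallGrowth`**: display (7a)'s conclusion from `_hchi'` + `hdef` + `ArchBallGrowth` (shared
with (8)) + the two prints `hF`, `hpseudo`/`hpseudo'`.
Nothing here says anything about the status of the Hodge conjecture for CM abelian varieties, which is NOT proved
(HC_CM is NOT proved by anyone in this repository).
-/

set_option autoImplicit false

noncomputable section

namespace Summit.Ventures.HodgeRepro.Tier4.Line4

open Summit.Ventures.HodgeRepro.Tier4.Common Summit.Ventures.HodgeRepro.Tier4.Line1
  Summit.Ventures.HodgeRepro.Tier4.Line4.L1Class NumberField MeasureTheory Topology Matrix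

open scoped ENNReal

section LayerCake

variable {k : Type} [Field k] [NumberField k] (W : PlaneData k) [MeasurableSpace (GA W)] [BorelSpace (GA W)]

omit [MeasurableSpace (GA W)] [BorelSpace (GA W)] in
/-- **the pointwise shell bound**: `‖f a‖ ≤ C₀ e^{−3 archDist a}` gives
`‖f a‖ₑ ≤ ∑' n, 1_{archDist ≤ n + 1}(a) · ofReal (C₀ e^{−3 n})` (the term `n = ⌊archDist a⌋₊`). -/
theorem enorm_le_tsum_indicator_of_decay {f : GA W → ℂ} (C₀ : ℝ)
    (hdecay : ∀ x, ‖f x‖ ≤ C₀ * Real.exp (-(3 * archDist W x))) (a : infinitePart W) :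
    ‖f a‖ₑ ≤ ∑' n : ℕ, Set.indicator {b : infinitePart W | archDist W (b : GA W) ≤ n + 1}
      (fun _ => ENNReal.ofReal (C₀ * Real.exp (-(3 * n)))) a := by
  set n₀ : ℕ := ⌊archDist W (a : GA W)⌋₊ with hn₀
  have hd0 : 0 ≤ archDist W (a : GA W) := archDist_nonneg W _
  have hle : (n₀ : ℝ) ≤ archDist W (a : GA W) := Nat.floor_le hd0
  have hlt : archDist W (a : GA W) < n₀ + 1 := Nat.lt_floor_add_one _
  have hmem : a ∈ {b : infinitePart W | archDist W (b : GA W) ≤ n₀ + 1} := hlt.le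
  refine le_trans ?_ (ENNReal.le_tsum n₀)
  rw [Set.indicator_of_mem hmem, ← ofReal_norm]
  refine ENNReal.ofReal_le_ofReal ((hdecay a).trans ?_)
  rcases le_or_gt 0 C₀ with hC | hC
  · refine mul_le_mul_of_nonneg_left (Real.exp_le_exp.2 ?_) hC
    linarith
  · exfalso
    exact absurd (norm_nonneg (f a))
      (not_le.2 (lt_of_le_of_lt (hdecay a) (mul_neg_of_neg_of_pos hC (Real.exp_pos _))))

/-- **the layer-cake bound**: under `ArchBallGrowth W μ∞` with constants `C α` and `‖f‖ ≤ C₀ e^{−3 archDist}`,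
`∫⁻ ‖f‖ₑ dμ∞ ≤ ∑' n, ofReal (C₀ e^{−3n}) · ofReal (C e^{α (n + 1)})`. -/
theorem lintegral_enorm_le_of_decay_of_growth (μinf : Measure (infinitePart W)) {C α : ℝ}
    (hgrowth : ∀ T : ℝ, μinf {a : infinitePart W | archDist W (a : GA W) ≤ T} ≤ ENNReal.ofReal (C * Real.exp (α * T)))
    {f : GA W → ℂ} (C₀ : ℝ) (hdecay : ∀ x, ‖f x‖ ≤ C₀ * Real.exp (-(3 * archDist W x))) :
    ∫⁻ a, ‖f a‖ₑ ∂μinf ≤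
      ∑' n : ℕ, ENNReal.ofReal (C₀ * Real.exp (-(3 * n))) * ENNReal.ofReal (C * Real.exp (α * (n + 1))) := by
  have hmeas : ∀ n : ℕ, MeasurableSet {b : infinitePart W | archDist W (b : GA W) ≤ n + 1} := fun n =>
    (isClosed_le ((continuous_archDist W).comp continuous_subtype_val) continuous_const).measurableSet
  calc ∫⁻ a, ‖f a‖ₑ ∂μinf
      ≤ ∫⁻ a, ∑' n : ℕ, Set.indicator {b : infinitePart W | archDist W (b : GA W) ≤ n + 1}
          (fun _ => ENNReal.ofReal (C₀ * Real.exp (-(3 * n)))) a ∂μinf :=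
        lintegral_mono fun a => enorm_le_tsum_indicator_of_decay W C₀ hdecay a
    _ = ∑' n : ℕ, ∫⁻ a, Set.indicator {b : infinitePart W | archDist W (b : GA W) ≤ n + 1}
          (fun _ => ENNReal.ofReal (C₀ * Real.exp (-(3 * n)))) a ∂μinf :=
        lintegral_tsum fun n => (measurable_const.indicator (hmeas n)).aemeasurable
    _ = ∑' n : ℕ, ENNReal.ofReal (C₀ * Real.exp (-(3 * n))) *
          μinf {b : infinitePart W | archDist W (b : GA W) ≤ n + 1} := by
        congr 1
        funext n
        rw [lintegral_indicator (hmeas n), setLIntegral_const]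
    _ ≤ ∑' n : ℕ, ENNReal.ofReal (C₀ * Real.exp (-(3 * n))) * ENNReal.ofReal (C * Real.exp (α * (n + 1))) :=
        ENNReal.tsum_le_tsum fun n => mul_le_mul' le_rfl (hgrowth (n + 1))

omit [BorelSpace (GA W)] in
/-- the geometric tail is finite: `∑' n, ofReal (C₀ e^{−3n}) · ofReal (C e^{α(n+1)}) < ∞` when `α < 3`. -/
theorem tsum_ofReal_exp_lt_top (C₀ C α : ℝ) (hα : α < 3) :
    ∑' n : ℕ, ENNReal.ofReal (C₀ * Real.exp (-(3 * n))) * ENNReal.ofReal (C * Real.exp (α * (n + 1))) < ⊤ := by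
  have hterm : ∀ n : ℕ, ENNReal.ofReal (C₀ * Real.exp (-(3 * n))) * ENNReal.ofReal (C * Real.exp (α * (n + 1))) ≤
      ENNReal.ofReal ((|C₀| * |C| * Real.exp α) * Real.exp (α - 3) ^ n) := by
    intro n
    have e1 : Real.exp (-(3 * n)) * Real.exp (α * (n + 1)) = Real.exp α * Real.exp (α - 3) ^ n := by
      rw [← Real.exp_nat_mul, ← Real.exp_add, ← Real.exp_add]
      congr 1
      ring
    calc ENNReal.ofReal (C₀ * Real.exp (-(3 * n))) * ENNReal.ofReal (C * Real.exp (α * (n + 1)))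
        ≤ ENNReal.ofReal (|C₀| * Real.exp (-(3 * n))) * ENNReal.ofReal (|C| * Real.exp (α * (n + 1))) :=
          mul_le_mul' (ENNReal.ofReal_le_ofReal (mul_le_mul_of_nonneg_right (le_abs_self _) (Real.exp_pos _).le))
            (ENNReal.ofReal_le_ofReal (mul_le_mul_of_nonneg_right (le_abs_self _) (Real.exp_pos _).le))
      _ = ENNReal.ofReal ((|C₀| * Real.exp (-(3 * n))) * (|C| * Real.exp (α * (n + 1)))) := by
          rw [← ENNReal.ofReal_mul (by positivity)]
      _ = ENNReal.ofReal ((|C₀| * |C| * Real.exp α) * Real.exp (α - 3) ^ n) := by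
          congr 1
          calc (|C₀| * Real.exp (-(3 * n))) * (|C| * Real.exp (α * (n + 1)))
              = (|C₀| * |C|) * (Real.exp (-(3 * n)) * Real.exp (α * (n + 1))) := by ring
            _ = (|C₀| * |C| * Real.exp α) * Real.exp (α - 3) ^ n := by rw [e1]; ring
  refine lt_of_le_of_lt (ENNReal.tsum_le_tsum hterm) ?_
  have hr0 : 0 ≤ Real.exp (α - 3) := (Real.exp_pos _).le
  have hr1 : Real.exp (α - 3) < 1 := by
    rw [Real.exp_lt_one_iff]; linarith
  have hsum : Summable fun n : ℕ => (|C₀| * |C| * Real.exp α) * Real.exp (α - 3) ^ n :=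
    (summable_geometric_of_lt_one hr0 hr1).mul_left _
  have hnn : ∀ n : ℕ, 0 ≤ (|C₀| * |C| * Real.exp α) * Real.exp (α - 3) ^ n := fun n => by positivity
  rw [← ENNReal.ofReal_tsum_of_nonneg hnn hsum]
  exact ENNReal.ofReal_lt_top

/-- **`G_∞`-INTEGRABILITY FROM WEIGHT-3 DECAY AND THE ARCHIMEDEAN BALL GROWTH**: a continuous `f` with
`‖f x‖ ≤ C₀ e^{−3 archDist x}` is `μ∞`-integrable on `G_∞` whenever `ArchBallGrowth W μ∞` (`α < 3`). -/
theorem integrable_of_decay_of_archBallGrowth (μinf : Measure (infinitePart W)) (hgrowth : ArchBallGrowth W μinf)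
    {f : GA W → ℂ} (hf : Continuous f) (hdecay : ∃ C₀ : ℝ, ∀ x, ‖f x‖ ≤ C₀ * Real.exp (-(3 * archDist W x))) :
    Integrable (fun a : infinitePart W => f a) μinf := by
  obtain ⟨C, α, _, hα, hball⟩ := hgrowth
  obtain ⟨C₀, hC₀⟩ := hdecay
  refine ⟨(hf.comp continuous_subtype_val).aestronglyMeasurable, ?_⟩
  rw [hasFiniteIntegral_iff_enorm]
  exact lt_of_le_of_lt (lintegral_enorm_le_of_decay_of_growth W μinf hball C₀ hC₀)
    (tsum_ofReal_exp_lt_top C₀ C α hα)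

end LayerCake

section Witness

variable {k : Type} [Field k] [NumberField k] (q : QuadData k) (a : Fin 4 → k)
  (g g' : Matrix (Fin 4) (Fin 4) k) (hgg' : g * g' = 1) (hg'g : g' * g = 1)
  (hgΩ : g * (PlaneData.mixedRow q (a 0) (a 2)).Ω = (PlaneData.mixedRow q (a 0) (a 2)).Ω * g)
  (lam : k) (hlam : lam ≠ 0)
  (hiso : g * (PlaneData.mixedRow q (a 1) (a 3)).B * gᵀ = lam • (PlaneData.mixedRow q (a 0) (a 2)).B)
  [MeasurableSpace (GA ((PlaneData.mixedRow q (a 0) (a 2)).withTransportedTorus g g' hgg' hg'g hgΩ))]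
  [BorelSpace (GA ((PlaneData.mixedRow q (a 0) (a 2)).withTransportedTorus g g' hgg' hg'g hgΩ))]
  (w₀ : InfinitePlace k) (eP' eM' : InfinitePlace k → ℤ)

include hlam in
/-- **the `hinf` of `isArchCoeffD_archWitness` from `ArchBallGrowth`** (under the decay hypotheses of `decay_archWitness`:
`U(1,1)` signs at `w₀`, definite at every `w′ ≠ w₀`). -/
theorem integrable_archWitness_of_archBallGrowth
    (μinf : Measure (infinitePart ((PlaneData.mixedRow q (a 0) (a 2)).withTransportedTorus g g' hgg' hg'g hgΩ)))
    (hgrowth : ArchBallGrowth ((PlaneData.mixedRow q (a 0) (a 2)).withTransportedTorus g g' hgg' hg'g hgΩ) μinf)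
    (hw₀ : w₀.IsReal) (hcm₀ : IsCMAt q w₀)
    (ha1 : 0 < (adToC w₀ (algebraMap k (Ad k) (a 1))).re) (ha3 : (adToC w₀ (algebraMap k (Ad k) (-1 * a 3))).re < 0)
    (hdef : ∀ w' : InfinitePlace k, w' ≠ w₀ → w'.IsReal ∧ IsCMAt q w' ∧
      0 < (adToC w' (algebraMap k (Ad k) (a 1))).re * (adToC w' (algebraMap k (Ad k) (-1 * a 3))).re) :
    Integrable (fun y : infinitePart ((PlaneData.mixedRow q (a 0) (a 2)).withTransportedTorus g g' hgg' hg'g hgΩ) =>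
      archWitness q a g g' hgg' hg'g hgΩ lam hiso w₀ eP' eM' y) μinf :=
  integrable_of_decay_of_archBallGrowth _ μinf hgrowth
    (continuous_archWitness q a g g' hgg' hg'g hgΩ lam hiso w₀ eP' eM' hw₀ hcm₀ ha1 ha3)
    (decay_archWitness q a g g' hgg' hg'g hgΩ lam hlam hiso w₀ eP' eM' hw₀ hcm₀ ha1 ha3 hdef)

include hlam in
/-- **the `hinf` of `isArchCoeffD_archWitness'` from `ArchBallGrowth`**. -/
theorem integrable_archWitness'_of_archBallGrowth
    (μinf : Measure (infinitePart ((PlaneData.mixedRow q (a 0) (a 2)).withTransportedTorus g g' hgg' hg'g hgΩ)))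
    (hgrowth : ArchBallGrowth ((PlaneData.mixedRow q (a 0) (a 2)).withTransportedTorus g g' hgg' hg'g hgΩ) μinf)
    (hw₀ : w₀.IsReal) (hcm₀ : IsCMAt q w₀)
    (ha1 : 0 < (adToC w₀ (algebraMap k (Ad k) (a 1))).re) (ha3 : (adToC w₀ (algebraMap k (Ad k) (-1 * a 3))).re < 0)
    (hdef : ∀ w' : InfinitePlace k, w' ≠ w₀ → w'.IsReal ∧ IsCMAt q w' ∧
      0 < (adToC w' (algebraMap k (Ad k) (a 1))).re * (adToC w' (algebraMap k (Ad k) (-1 * a 3))).re) :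
    Integrable (fun y : infinitePart ((PlaneData.mixedRow q (a 0) (a 2)).withTransportedTorus g g' hgg' hg'g hgΩ) =>
      archWitness' q a g g' hgg' hg'g hgΩ lam hiso w₀ eP' eM' y) μinf :=
  integrable_of_decay_of_archBallGrowth _ μinf hgrowth
    (continuous_archWitness' q a g g' hgg' hg'g hgΩ lam hiso w₀ eP' eM' hw₀ hcm₀ ha1 ha3)
    (decay_archWitness' q a g g' hgg' hg'g hgΩ lam hlam hiso w₀ eP' eM' hw₀ hcm₀ ha1 ha3 hdef)

end Witness

section Final

variable {k : Type} [Field k] [NumberField k] (q : QuadData k) (a : Fin 4 → k)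
  (g g' : Matrix (Fin 4) (Fin 4) k) (hgg' : g * g' = 1) (hg'g : g' * g = 1)
  (hgΩ : g * (PlaneData.mixedRow q (a 0) (a 2)).Ω = (PlaneData.mixedRow q (a 0) (a 2)).Ω * g)
  (lam : k) (hlam : lam ≠ 0)
  (hiso : g * (PlaneData.mixedRow q (a 1) (a 3)).B * gᵀ = lam • (PlaneData.mixedRow q (a 0) (a 2)).B)
  [MeasurableSpace (GA ((PlaneData.mixedRow q (a 0) (a 2)).withTransportedTorus g g' hgg' hg'g hgΩ))]
  [BorelSpace (GA ((PlaneData.mixedRow q (a 0) (a 2)).withTransportedTorus g g' hgg' hg'g hgΩ))]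
  (S : RTF.Setting (GA ((PlaneData.mixedRow q (a 0) (a 2)).withTransportedTorus g g' hgg' hg'g hgΩ)))
  (R : RTFData ((PlaneData.mixedRow q (a 0) (a 2)).withTransportedTorus g g' hgg' hg'g hgΩ))
  (w₀ : InfinitePlace k) (eP eM eP' eM' : InfinitePlace k → ℤ)
  (γ₀ : GA ((PlaneData.mixedRow q (a 0) (a 2)).withTransportedTorus g g' hgg' hg'g hgΩ))
  (νinf : Measure (torusInf ((PlaneData.mixedRow q (a 0) (a 2)).withTransportedTorus g g' hgg' hg'g hgΩ)))
  (νinf' : Measure (torusInf' ((PlaneData.mixedRow q (a 0) (a 2)).withTransportedTorus g g' hgg' hg'g hgΩ)))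

include hlam in
/-- **`D3CoeffData'` FROM THE BALL GROWTH** (holomorphic branch): the `integrable` print of `d3CoeffData'_archWitness_of_fourier`
replaced by display (8)'s `ArchBallGrowth W μ∞` — the prints left are `hF` and `hpseudo` / `hpseudo'`. -/
theorem d3CoeffData'_archWitness_of_archBallGrowth [S.μ.IsHaarMeasure]
    (μinf : Measure (infinitePart ((PlaneData.mixedRow q (a 0) (a 2)).withTransportedTorus g g' hgg' hg'g hgΩ)))
    [μinf.IsHaarMeasure]
    (hgrowth : ArchBallGrowth ((PlaneData.mixedRow q (a 0) (a 2)).withTransportedTorus g g' hgg' hg'g hgΩ) μinf)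
    [CompactSpace (torusInf' ((PlaneData.mixedRow q (a 0) (a 2)).withTransportedTorus g g' hgg' hg'g hgΩ))]
    [νinf'.IsHaarMeasure]
    (hall : ∀ w : InfinitePlace k, w.IsReal ∧ IsCMAt q w)
    (ha1 : 0 < (adToC w₀ (algebraMap k (Ad k) (a 1))).re) (ha3 : (adToC w₀ (algebraMap k (Ad k) (-1 * a 3))).re < 0)
    (hdef : ∀ w' : InfinitePlace k, w' ≠ w₀ → w'.IsReal ∧ IsCMAt q w' ∧
      0 < (adToC w' (algebraMap k (Ad k) (a 1))).re * (adToC w' (algebraMap k (Ad k) (-1 * a 3))).re)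
    (he : eP' w₀ = eM' w₀ + 3)
    (hchi' : ∀ w : InfinitePlace k, ChiMatchesAt' ((PlaneData.mixedRow q (a 0) (a 2)).withTransportedTorus g g' hgg' hg'g hgΩ)
      q w g g' (eP' w) (eM' w) R.chi')
    (hF : (∫ t : torusInf ((PlaneData.mixedRow q (a 0) (a 2)).withTransportedTorus g g' hgg' hg'g hgΩ),
        R.chi t * archWitness q a g g' hgg' hg'g hgΩ lam hiso w₀ eP' eM'
          (((t : torusT ((PlaneData.mixedRow q (a 0) (a 2)).withTransportedTorus g g' hgg' hg'g hgΩ)) :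
            GA ((PlaneData.mixedRow q (a 0) (a 2)).withTransportedTorus g g' hgg' hg'g hgΩ))⁻¹ * γ₀) ∂νinf) ≠ 0)
    (hpseudo : ∀ ffin : GA ((PlaneData.mixedRow q (a 0) (a 2)).withTransportedTorus g g' hgg' hg'g hgΩ) → ℂ,
      L1Class.IsFinFactor ((PlaneData.mixedRow q (a 0) (a 2)).withTransportedTorus g g' hgg' hg'g hgΩ) ffin →
      IsPseudoCoeffAt ((PlaneData.mixedRow q (a 0) (a 2)).withTransportedTorus g g' hgg' hg'g hgΩ) S q w₀ eP eM
        (RTF.cj (L1Class.prodFn ((PlaneData.mixedRow q (a 0) (a 2)).withTransportedTorus g g' hgg' hg'g hgΩ)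
          (archWitness q a g g' hgg' hg'g hgΩ lam hiso w₀ eP' eM') ffin)))
    (hpseudo' : ∀ ffin : GA ((PlaneData.mixedRow q (a 0) (a 2)).withTransportedTorus g g' hgg' hg'g hgΩ) → ℂ,
      L1Class.IsFinFactor ((PlaneData.mixedRow q (a 0) (a 2)).withTransportedTorus g g' hgg' hg'g hgΩ) ffin →
      IsPseudoCoeffAt' ((PlaneData.mixedRow q (a 0) (a 2)).withTransportedTorus g g' hgg' hg'g hgΩ) S q g g' w₀ eP' eM'
        (RTF.cj (L1Class.prodFn ((PlaneData.mixedRow q (a 0) (a 2)).withTransportedTorus g g' hgg' hg'g hgΩ)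
          (archWitness q a g g' hgg' hg'g hgΩ lam hiso w₀ eP' eM') ffin))) :
    L1Class.D3CoeffData' ((PlaneData.mixedRow q (a 0) (a 2)).withTransportedTorus g g' hgg' hg'g hgΩ) S R q g g' w₀
      eP eM eP' eM' γ₀ νinf νinf' :=
  d3CoeffData'_archWitness_of_fourier q a g g' hgg' hg'g hgΩ lam hlam hiso S R w₀ eP eM eP' eM' γ₀ νinf νinf' μinf hall
    ha1 ha3 hdef he hchi'
    (integrable_archWitness_of_archBallGrowth q a g g' hgg' hg'g hgΩ lam hlam hiso w₀ eP' eM' μinf hgrowth (hall w₀).1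
      (hall w₀).2 ha1 ha3 hdef)
    hF hpseudo hpseudo'

include hlam in
/-- **`D3CoeffData'` FROM THE BALL GROWTH** (antiholomorphic branch `eM′ w₀ = eP′ w₀ + 3`). -/
theorem d3CoeffData'_archWitness'_of_archBallGrowth [S.μ.IsHaarMeasure]
    (μinf : Measure (infinitePart ((PlaneData.mixedRow q (a 0) (a 2)).withTransportedTorus g g' hgg' hg'g hgΩ)))
    [μinf.IsHaarMeasure]
    (hgrowth : ArchBallGrowth ((PlaneData.mixedRow q (a 0) (a 2)).withTransportedTorus g g' hgg' hg'g hgΩ) μinf)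
    [CompactSpace (torusInf' ((PlaneData.mixedRow q (a 0) (a 2)).withTransportedTorus g g' hgg' hg'g hgΩ))]
    [νinf'.IsHaarMeasure]
    (hall : ∀ w : InfinitePlace k, w.IsReal ∧ IsCMAt q w)
    (ha1 : 0 < (adToC w₀ (algebraMap k (Ad k) (a 1))).re) (ha3 : (adToC w₀ (algebraMap k (Ad k) (-1 * a 3))).re < 0)
    (hdef : ∀ w' : InfinitePlace k, w' ≠ w₀ → w'.IsReal ∧ IsCMAt q w' ∧
      0 < (adToC w' (algebraMap k (Ad k) (a 1))).re * (adToC w' (algebraMap k (Ad k) (-1 * a 3))).re)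
    (he : eM' w₀ = eP' w₀ + 3)
    (hchi' : ∀ w : InfinitePlace k, ChiMatchesAt' ((PlaneData.mixedRow q (a 0) (a 2)).withTransportedTorus g g' hgg' hg'g hgΩ)
      q w g g' (eP' w) (eM' w) R.chi')
    (hF : (∫ t : torusInf ((PlaneData.mixedRow q (a 0) (a 2)).withTransportedTorus g g' hgg' hg'g hgΩ),
        R.chi t * archWitness' q a g g' hgg' hg'g hgΩ lam hiso w₀ eP' eM'
          (((t : torusT ((PlaneData.mixedRow q (a 0) (a 2)).withTransportedTorus g g' hgg' hg'g hgΩ)) :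
            GA ((PlaneData.mixedRow q (a 0) (a 2)).withTransportedTorus g g' hgg' hg'g hgΩ))⁻¹ * γ₀) ∂νinf) ≠ 0)
    (hpseudo : ∀ ffin : GA ((PlaneData.mixedRow q (a 0) (a 2)).withTransportedTorus g g' hgg' hg'g hgΩ) → ℂ,
      L1Class.IsFinFactor ((PlaneData.mixedRow q (a 0) (a 2)).withTransportedTorus g g' hgg' hg'g hgΩ) ffin →
      IsPseudoCoeffAt ((PlaneData.mixedRow q (a 0) (a 2)).withTransportedTorus g g' hgg' hg'g hgΩ) S q w₀ eP eM
        (RTF.cj (L1Class.prodFn ((PlaneData.mixedRow q (a 0) (a 2)).withTransportedTorus g g' hgg' hg'g hgΩ)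
          (archWitness' q a g g' hgg' hg'g hgΩ lam hiso w₀ eP' eM') ffin)))
    (hpseudo' : ∀ ffin : GA ((PlaneData.mixedRow q (a 0) (a 2)).withTransportedTorus g g' hgg' hg'g hgΩ) → ℂ,
      L1Class.IsFinFactor ((PlaneData.mixedRow q (a 0) (a 2)).withTransportedTorus g g' hgg' hg'g hgΩ) ffin →
      IsPseudoCoeffAt' ((PlaneData.mixedRow q (a 0) (a 2)).withTransportedTorus g g' hgg' hg'g hgΩ) S q g g' w₀ eP' eM'
        (RTF.cj (L1Class.prodFn ((PlaneData.mixedRow q (a 0) (a 2)).withTransportedTorus g g' hgg' hg'g hgΩ)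
          (archWitness' q a g g' hgg' hg'g hgΩ lam hiso w₀ eP' eM') ffin))) :
    L1Class.D3CoeffData' ((PlaneData.mixedRow q (a 0) (a 2)).withTransportedTorus g g' hgg' hg'g hgΩ) S R q g g' w₀
      eP eM eP' eM' γ₀ νinf νinf' :=
  d3CoeffData'_archWitness'_of_fourier q a g g' hgg' hg'g hgΩ lam hlam hiso S R w₀ eP eM eP' eM' γ₀ νinf νinf' μinf hall
    ha1 ha3 hdef he hchi'
    (integrable_archWitness'_of_archBallGrowth q a g g' hgg' hg'g hgΩ lam hlam hiso w₀ eP' eM' μinf hgrowth (hall w₀).1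
      (hall w₀).2 ha1 ha3 hdef)
    hF hpseudo hpseudo'

end Final

end Summit.Ventures.HodgeRepro.Tier4.Line4

end
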